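import Summits.Parity.GeneralizedHardyLittlewood.Theorems.FordMaynardSieveConst01651SieveConst01651FiveGeneric
import HarnessLib

/-!
# Route `FordMaynardSieveConst01651`, target `SieveConst01651` (stmt-Parity-19185), stub `stub_coneCertClosed`,
# residue `h5`: the TYPE of a generic point (pruning lemmas for the dimension-5 checker)

Def-free helper file.  A dimension-5 type checker enumerates cell vectors `a = (cellIdx xᵢ)ᵢ` and band bits; its
soundness needs that every GENERIC point of `ℋ₅` produces a type passing the pruning rules.  Recorded here:

* `cellIdx_mono` — `cellIdx` is monotone on `(ν₀, 1/2)` (so the cell vector of a monotone point is monotone);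
* `cellIdx_lt_74_of_five` — in dimension 5 every coordinate is `< 1 − 4ν₀ = 0.3396 < e₇₄`, so all cells are `≤ 73`;
* `sum_certEdge_lt_one` / `one_lt_sum_certEdge_succ` — R1: `∑ᵢ e_{aᵢ} < 1 < ∑ᵢ e_{aᵢ+1}` for the cell vector of a
  generic point with `|x| = 1`;
* `pair_sum_mem_Ioo` — R2: `e_{aᵢ} + e_{aⱼ} < xᵢ + xⱼ < e_{aᵢ+1} + e_{aⱼ+1}` (what makes a band bit consistent);
* `bandIdx_eq_zero_iff` — the band bit reads `|x_A| < c₀`.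

References: [FordMaynard2024PrimeSieves] arXiv:2407.14368, §8.2 (the certificate refines (8.2 b)).
-/

noncomputable section

open Finset
open scoped Classical
open Literature.NumberTheory.Sieve Literature.NumberTheory.Sieve.FordMaynard

namespace Summit.Parity.GeneralizedHardyLittlewood.FordMaynardSieveConst01651SieveConst01651

/-- `cellIdx` is monotone on `(ν₀, 1/2)`. [folklore] -/
theorem cellIdx_mono {s t : ℝ} (hs : (1651 / 10000 : ℝ) < s) (hst : s ≤ t) (ht : t < 1 / 2) :
    cellIdx s ≤ cellIdx t := by
  have hS := cellIdx_spec hs (lt_of_le_of_lt hst ht)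
  have hT := cellIdx_spec (lt_of_lt_of_le hs hst) ht
  by_contra h
  push Not at h
  -- `cellIdx t + 1 ≤ cellIdx s`, so `e_{cellIdx t + 1} ≤ e_{cellIdx s} ≤ s ≤ t < e_{cellIdx t + 1}`
  have hle : ((certEdge (cellIdx t + 1) : ℚ) : ℝ) ≤ ((certEdge (cellIdx s) : ℚ) : ℝ) := by
    rcases (show cellIdx t + 1 ≤ cellIdx s by omega).lt_or_eq with h' | h'
    · exact (certEdge_cast_lt h' (by omega)).le
    · rw [h']
  linarith [hS.2.1, hT.2.2]

/-- In dimension 5 every coordinate of a point of `ℋ₅` lies in a cell `≤ 73` (`1 − 4ν₀ = 0.3396 ≤ e₇₄`). [folklore] -/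
theorem cellIdx_lt_74_of_five {x : Fin 5 → ℝ} (hbox : ∀ i, (1651 / 10000 : ℝ) < x i) (hsum : ∑ i, x i = 1)
    (i : Fin 5) : cellIdx (x i) < 74 := by
  have hlt := apply_lt_of_five hbox hsum i
  have h74 : ((certEdge 74 : ℚ) : ℝ) = 1 / 2 - 1651 / 10000 + ((74 : ℕ) - 72 : ℝ) * (1651 / 120000) :=
    certEdge_cast_of_ge (by norm_num) (by norm_num)
  have hx74 : x i < ((certEdge 74 : ℚ) : ℝ) := by rw [h74]; push_cast; linarith
  have hhalf : x i < 1 / 2 := by linarith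
  have hs := cellIdx_spec (hbox i) hhalf
  by_contra h
  push Not at h
  have : ((certEdge 74 : ℚ) : ℝ) ≤ ((certEdge (cellIdx (x i)) : ℚ) : ℝ) := by
    rcases h.lt_or_eq with h' | h'
    · exact (certEdge_cast_lt h' (by omega)).le
    · rw [h']
  linarith [hs.2.1]

/-- **R1, lower half.** For a point with every coordinate in `(ν₀, 1/2)` and `|x| = 1`: `∑ᵢ e_{cellIdx xᵢ} ≤ 1`, strictly
if some coordinate is off the lower edge of its cell (in particular at generic points). [folklore] -/
theorem sum_certEdge_lt_one {k : ℕ} {x : Fin k → ℝ} (hopen : ∀ i, x i ∈ openSmall) (hsum : ∑ i, x i = 1)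
    (hk : 0 < k) : ∑ i, ((certEdge (cellIdx (x i)) : ℚ) : ℝ) < 1 := by
  rw [← hsum]
  have hne : (Finset.univ : Finset (Fin k)).Nonempty := Finset.univ_nonempty_iff.2 ⟨⟨0, hk⟩⟩
  exact Finset.sum_lt_sum_of_nonempty hne (fun i _ => certEdge_cellIdx_lt (hopen i))

/-- **R1, upper half.** `1 < ∑ᵢ e_{cellIdx xᵢ + 1}`. [folklore] -/
theorem one_lt_sum_certEdge_succ {k : ℕ} {x : Fin k → ℝ} (hopen : ∀ i, x i ∈ openSmall) (hsum : ∑ i, x i = 1)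
    (hk : 0 < k) : 1 < ∑ i, ((certEdge (cellIdx (x i) + 1) : ℚ) : ℝ) := by
  rw [← hsum]
  have hne : (Finset.univ : Finset (Fin k)).Nonempty := Finset.univ_nonempty_iff.2 ⟨⟨0, hk⟩⟩
  exact Finset.sum_lt_sum_of_nonempty hne (fun i _ => (cellIdx_spec (hopen i).1 (hopen i).2.1).2.2)

/-- **R2.** A pair sum lies strictly between the sums of the cells' lower and upper edges. [folklore] -/
theorem pair_sum_mem_Ioo {s t : ℝ} (hs : s ∈ openSmall) (ht : t ∈ openSmall) :
    ((certEdge (cellIdx s) : ℚ) : ℝ) + ((certEdge (cellIdx t) : ℚ) : ℝ) < s + t ∧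
      s + t < ((certEdge (cellIdx s + 1) : ℚ) : ℝ) + ((certEdge (cellIdx t + 1) : ℚ) : ℝ) := by
  have h1 := certEdge_cellIdx_lt hs
  have h2 := certEdge_cellIdx_lt ht
  have h3 := (cellIdx_spec hs.1 hs.2.1).2.2
  have h4 := (cellIdx_spec ht.1 ht.2.1).2.2
  constructor <;> linarith

/-- The band bit: `bandIdx u = 0 ↔ u < c₀`, and otherwise `bandIdx u = 1`. [folklore] -/
theorem bandIdx_eq_zero_iff (u : ℝ) : (bandIdx u = 0 ↔ u < 8349 / 20000) ∧ (bandIdx u ≠ 0 → bandIdx u = 1) := by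
  unfold bandIdx
  constructor
  · constructor
    · intro h; by_contra hu; rw [if_neg hu] at h; exact one_ne_zero h
    · intro h; rw [if_pos h]
  · intro h; by_cases hu : u < 8349 / 20000
    · rw [if_pos hu] at h; exact absurd rfl h
    · rw [if_neg hu]

end Summit.Parity.GeneralizedHardyLittlewood.FordMaynardSieveConst01651SieveConst01651

end
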